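import Summits.AtomisticToContinuum.Crystallization.Theorems.FrustratedLawDichotomyCollarNonExempt

/-!
# FrustratedLawDichotomy · crux `AperiodicFrustratedLawGap` (stmt-AtomisticToContinuum-27623) — the BREGMAN MENU for the move-test certificate
# of `…CollarNonExempt` (decomp-a2c, prover hand 2, generation 16; critic row 578 (B)(1))

`…CollarNonExempt.not_moveUnstableCore_of_bregmanCert` asks, per bond, for a constant `c` with
`c (P − Q)² ≤ Ṽ(P) − Ṽ(Q) − Ṽ'(Q)(P − Q)` for all `P` in the bond's range `[Plo, Phi]` (`Ṽ(P) = P⁻⁶/12 − P⁻³/6`, `Q` = the squared bond length).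
In the inverse variables `u = Q⁻¹`, `v = P⁻¹` the Bregman divergence FACTORS EXACTLY (the identity behind
`Literature…LennardJonesSquaredDistance.lennardJonesSq_bregman_nonneg`):

  `Ṽ(P) − Ṽ(Q) − Ṽ'(Q)(P − Q) = (P − Q)² · G(u, v)/12`, `G(u, v) = u²v·(6u⁵ + 5u⁴v + 4u³v² + 3u²v³ + 2uv⁴ + v⁵) − u²v·(6u² + 4uv + 2v²)`

(`G(u, u) = 6 Ṽ''(Q)`), so THE OPTIMAL constant on a range is `min_v G(u, v)/12`, and since both groups of monomials are INCREASING in `v > 0`,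
`G ≥ Pos(u, Phi⁻¹) − Neg(u, Plo⁻¹)` on the range.  Hence the menu entries (all closed-form, rational on rational data, NO range restriction —
valid for compressed, nearest and far bonds alike):

* ★ `bregman_ge_of_posNeg` — `12 c ≤ Pos(Q⁻¹, Phi⁻¹) − Neg(Q⁻¹, Plo⁻¹) ⟹ c (P − Q)² ≤ Breg` for `P ∈ [Plo, Phi]` (one piece; e.g. nearest bond
  `Q = 0.9409`, move radius `1/20`: `c = 0.58`, optimum `1.05`);
* ★ `bregman_ge_of_pieces` — the same with the range cut into pieces (8 pieces: `c = 0.999`), the form a `decide` checker consumes.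
All `[folklore]` (elementary algebra on Blanc–Lewin's formula (3)); 0 sorry.
-/

noncomputable section

namespace Summit.AtomisticToContinuum.Crystallization.Theorems.FrustratedLawDichotomyBregmanMenu

/-- ★ **THE EXACT FACTORISATION** of the Bregman divergence of `Ṽ` in the inverse variables `u = Q⁻¹`, `v = P⁻¹` (`P, Q ≠ 0`). [folklore] -/
theorem bregman_eq_factor {P Q : ℝ} (hP : P ≠ 0) (hQ : Q ≠ 0) :
    ((1 / 12) * P⁻¹ ^ 6 - (1 / 6) * P⁻¹ ^ 3) - ((1 / 12) * Q⁻¹ ^ 6 - (1 / 6) * Q⁻¹ ^ 3) -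
        (-(1 / 2) * Q⁻¹ ^ 7 + (1 / 2) * Q⁻¹ ^ 4) * (P - Q) =
      (P - Q) ^ 2 * ((Q⁻¹ ^ 2 * P⁻¹ * (6 * Q⁻¹ ^ 5 + 5 * Q⁻¹ ^ 4 * P⁻¹ + 4 * Q⁻¹ ^ 3 * P⁻¹ ^ 2 + 3 * Q⁻¹ ^ 2 * P⁻¹ ^ 3 +
          2 * Q⁻¹ * P⁻¹ ^ 4 + P⁻¹ ^ 5) - Q⁻¹ ^ 2 * P⁻¹ * (6 * Q⁻¹ ^ 2 + 4 * Q⁻¹ * P⁻¹ + 2 * P⁻¹ ^ 2)) / 12) := by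
  field_simp
  ring

/-- Monotonicity of the positive group `Pos(u, v) = u²v(6u⁵ + 5u⁴v + 4u³v² + 3u²v³ + 2uv⁴ + v⁵)` in `v ≥ 0` (`u ≥ 0`). [folklore] -/
theorem pos_mono {u a v : ℝ} (hu : 0 ≤ u) (ha : 0 ≤ a) (hav : a ≤ v) :
    u ^ 2 * a * (6 * u ^ 5 + 5 * u ^ 4 * a + 4 * u ^ 3 * a ^ 2 + 3 * u ^ 2 * a ^ 3 + 2 * u * a ^ 4 + a ^ 5) ≤
      u ^ 2 * v * (6 * u ^ 5 + 5 * u ^ 4 * v + 4 * u ^ 3 * v ^ 2 + 3 * u ^ 2 * v ^ 3 + 2 * u * v ^ 4 + v ^ 5) := by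
  have hv : 0 ≤ v := ha.trans hav
  gcongr

/-- Monotonicity of the negative group `Neg(u, v) = u²v(6u² + 4uv + 2v²)` in `v ≥ 0` (`u ≥ 0`). [folklore] -/
theorem neg_mono {u v b : ℝ} (hu : 0 ≤ u) (hv : 0 ≤ v) (hvb : v ≤ b) :
    u ^ 2 * v * (6 * u ^ 2 + 4 * u * v + 2 * v ^ 2) ≤ u ^ 2 * b * (6 * u ^ 2 + 4 * u * b + 2 * b ^ 2) := by
  have hb : 0 ≤ b := hv.trans hvb
  gcongr

/-- ★★ **MENU ENTRY (one piece)**: for `0 < Q`, `0 < Plo ≤ P ≤ Phi` and `12 c ≤ Pos(Q⁻¹, Phi⁻¹) − Neg(Q⁻¹, Plo⁻¹)`, the Bregman constant `c` is valid at `P`: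
`c (P − Q)² ≤ Ṽ(P) − Ṽ(Q) − Ṽ'(Q)(P − Q)`. [folklore] -/
theorem bregman_ge_of_posNeg {Q P Plo Phi c : ℝ} (hQ : 0 < Q) (hPlo : 0 < Plo) (h1 : Plo ≤ P) (h2 : P ≤ Phi)
    (hc : 12 * c ≤ Q⁻¹ ^ 2 * Phi⁻¹ * (6 * Q⁻¹ ^ 5 + 5 * Q⁻¹ ^ 4 * Phi⁻¹ + 4 * Q⁻¹ ^ 3 * Phi⁻¹ ^ 2 + 3 * Q⁻¹ ^ 2 * Phi⁻¹ ^ 3 +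
        2 * Q⁻¹ * Phi⁻¹ ^ 4 + Phi⁻¹ ^ 5) - Q⁻¹ ^ 2 * Plo⁻¹ * (6 * Q⁻¹ ^ 2 + 4 * Q⁻¹ * Plo⁻¹ + 2 * Plo⁻¹ ^ 2)) :
    c * (P - Q) ^ 2 ≤
      ((1 / 12) * P⁻¹ ^ 6 - (1 / 6) * P⁻¹ ^ 3) - ((1 / 12) * Q⁻¹ ^ 6 - (1 / 6) * Q⁻¹ ^ 3) -
        (-(1 / 2) * Q⁻¹ ^ 7 + (1 / 2) * Q⁻¹ ^ 4) * (P - Q) := by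
  have hP : 0 < P := hPlo.trans_le h1
  have hPhi : 0 < Phi := hP.trans_le h2
  rw [bregman_eq_factor hP.ne' hQ.ne']
  have hu : 0 ≤ Q⁻¹ := inv_nonneg.2 hQ.le
  have hv : 0 ≤ P⁻¹ := inv_nonneg.2 hP.le
  have ha : 0 ≤ Phi⁻¹ := inv_nonneg.2 hPhi.le
  have hav : Phi⁻¹ ≤ P⁻¹ := inv_anti₀ hP h2
  have hvb : P⁻¹ ≤ Plo⁻¹ := inv_anti₀ hPlo h1
  have hpos := pos_mono hu ha hav
  have hneg := neg_mono hu hv hvb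
  have hsq : 0 ≤ (P - Q) ^ 2 := sq_nonneg _
  have hG : 12 * c ≤ Q⁻¹ ^ 2 * P⁻¹ * (6 * Q⁻¹ ^ 5 + 5 * Q⁻¹ ^ 4 * P⁻¹ + 4 * Q⁻¹ ^ 3 * P⁻¹ ^ 2 + 3 * Q⁻¹ ^ 2 * P⁻¹ ^ 3 +
        2 * Q⁻¹ * P⁻¹ ^ 4 + P⁻¹ ^ 5) - Q⁻¹ ^ 2 * P⁻¹ * (6 * Q⁻¹ ^ 2 + 4 * Q⁻¹ * P⁻¹ + 2 * P⁻¹ ^ 2) := by linarith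
  have : c ≤ (Q⁻¹ ^ 2 * P⁻¹ * (6 * Q⁻¹ ^ 5 + 5 * Q⁻¹ ^ 4 * P⁻¹ + 4 * Q⁻¹ ^ 3 * P⁻¹ ^ 2 + 3 * Q⁻¹ ^ 2 * P⁻¹ ^ 3 +
        2 * Q⁻¹ * P⁻¹ ^ 4 + P⁻¹ ^ 5) - Q⁻¹ ^ 2 * P⁻¹ * (6 * Q⁻¹ ^ 2 + 4 * Q⁻¹ * P⁻¹ + 2 * P⁻¹ ^ 2)) / 12 := by
    rw [le_div_iff₀ (by norm_num)]; linarith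
  calc c * (P - Q) ^ 2 = (P - Q) ^ 2 * c := mul_comm _ _
    _ ≤ _ := mul_le_mul_of_nonneg_left this hsq

/-- ★★ **MENU ENTRY (pieces)**: if the range containing `P` is covered by pieces `[lo i, hi i]` (`P` lies in one of them, all `0 < lo i`) and
`12 c ≤ Pos(Q⁻¹, (hi i)⁻¹) − Neg(Q⁻¹, (lo i)⁻¹)` on EVERY piece, then `c` is a valid Bregman constant at `P`. [folklore] -/
theorem bregman_ge_of_pieces {ι : Type*} {Q P c : ℝ} (lo hi : ι → ℝ) (hQ : 0 < Q) (hlo : ∀ i, 0 < lo i)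
    (hcover : ∃ i, lo i ≤ P ∧ P ≤ hi i)
    (hc : ∀ i, 12 * c ≤ Q⁻¹ ^ 2 * (hi i)⁻¹ * (6 * Q⁻¹ ^ 5 + 5 * Q⁻¹ ^ 4 * (hi i)⁻¹ + 4 * Q⁻¹ ^ 3 * (hi i)⁻¹ ^ 2 +
        3 * Q⁻¹ ^ 2 * (hi i)⁻¹ ^ 3 + 2 * Q⁻¹ * (hi i)⁻¹ ^ 4 + (hi i)⁻¹ ^ 5) -
      Q⁻¹ ^ 2 * (lo i)⁻¹ * (6 * Q⁻¹ ^ 2 + 4 * Q⁻¹ * (lo i)⁻¹ + 2 * (lo i)⁻¹ ^ 2)) :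
    c * (P - Q) ^ 2 ≤
      ((1 / 12) * P⁻¹ ^ 6 - (1 / 6) * P⁻¹ ^ 3) - ((1 / 12) * Q⁻¹ ^ 6 - (1 / 6) * Q⁻¹ ^ 3) -
        (-(1 / 2) * Q⁻¹ ^ 7 + (1 / 2) * Q⁻¹ ^ 4) * (P - Q) := by
  obtain ⟨i, h1, h2⟩ := hcover
  exact bregman_ge_of_posNeg hQ (hlo i) h1 h2 (hc i)

/-- Consecutive pieces cover: if `e 0 ≤ P ≤ e n` for a chain `e : ℕ → ℝ`, then `P ∈ [e i, e (i+1)]` for some `i < n`. [folklore] -/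
theorem exists_piece_of_chain (e : ℕ → ℝ) {n : ℕ} {P : ℝ} (h0 : e 0 ≤ P) (hn : P ≤ e n) (hn0 : 0 < n) :
    ∃ i, i < n ∧ e i ≤ P ∧ P ≤ e (i + 1) := by
  induction n with
  | zero => exact absurd hn0 (lt_irrefl 0)
  | succ n ih =>
    by_cases hle : P ≤ e n
    · rcases Nat.eq_zero_or_pos n with hz | hpos
      · subst hz
        exact ⟨0, Nat.lt_succ_self 0, h0, hn⟩
      · obtain ⟨i, hi, h1, h2⟩ := ih hle hpos
        exact ⟨i, Nat.lt_succ_of_lt hi, h1, h2⟩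
    · push Not at hle
      exact ⟨n, Nat.lt_succ_self n, hle.le, hn⟩

/-- ★ **MENU ENTRY (consecutive pieces)**: a chain `Plo = e 0 ≤ e 1 ≤ … ≤ e n = Phi` (`0 < e 0`, `0 < n`) with the one-piece condition on every
`[e i, e (i+1)]`, `i < n`, gives a valid Bregman constant on the whole range `[Plo, Phi]` — the hypothesis `hbreg` of
`…CollarNonExempt.not_moveUnstableCore_of_bregmanCert` for this bond. [folklore] -/
theorem bregman_ge_of_chain (e : ℕ → ℝ) {n : ℕ} {Q c : ℝ} (hQ : 0 < Q) (he0 : 0 < e 0) (hmono : ∀ i, i < n → e i ≤ e (i + 1)) (hn : 0 < n)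
    (hc : ∀ i, i < n → 12 * c ≤ Q⁻¹ ^ 2 * (e (i + 1))⁻¹ * (6 * Q⁻¹ ^ 5 + 5 * Q⁻¹ ^ 4 * (e (i + 1))⁻¹ + 4 * Q⁻¹ ^ 3 * (e (i + 1))⁻¹ ^ 2 +
        3 * Q⁻¹ ^ 2 * (e (i + 1))⁻¹ ^ 3 + 2 * Q⁻¹ * (e (i + 1))⁻¹ ^ 4 + (e (i + 1))⁻¹ ^ 5) -
      Q⁻¹ ^ 2 * (e i)⁻¹ * (6 * Q⁻¹ ^ 2 + 4 * Q⁻¹ * (e i)⁻¹ + 2 * (e i)⁻¹ ^ 2)) :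
    ∀ P : ℝ, e 0 ≤ P → P ≤ e n →
      c * (P - Q) ^ 2 ≤
        ((1 / 12) * P⁻¹ ^ 6 - (1 / 6) * P⁻¹ ^ 3) - ((1 / 12) * Q⁻¹ ^ 6 - (1 / 6) * Q⁻¹ ^ 3) -
          (-(1 / 2) * Q⁻¹ ^ 7 + (1 / 2) * Q⁻¹ ^ 4) * (P - Q) := by
  -- every node of the chain is positive
  have hpos : ∀ i, i ≤ n → 0 < e i := by
    intro i hi
    induction i with
    | zero => exact he0
    | succ i ih => exact (ih (Nat.le_of_succ_le hi)).trans_le (hmono i (Nat.lt_of_succ_le hi))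
  intro P h0 hP
  obtain ⟨i, hi, h1, h2⟩ := exists_piece_of_chain e h0 hP hn
  exact bregman_ge_of_posNeg hQ (hpos i hi.le) h1 h2 (hc i hi)

end Summit.AtomisticToContinuum.Crystallization.Theorems.FrustratedLawDichotomyBregmanMenu

end
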